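import Literature.Barriers.AtomisticToContinuum.HardDiskTranslationInvarianceFinalSteps
import Mathlib.MeasureTheory.Measure.Haar.InnerProductSpace
import Mathlib.Dynamics.Ergodic.MeasurePreserving
import HarnessLib

/-!
# "By symmetry we may assume `e = e₁`": the coordinate swap of the hard-disc model
# (Richthammer 2007, §5.1)

Part of the bottom-up programme for `Richthammer2007_ineq35` via `Richthammer2007_ineq58`
(`HardDiskTranslationInvarianceFinalSteps.lean`). The construction of §5 is carried out for the
direction `e = e₁` only: "we fix `τ ∈ [0, 1/2]`, and by symmetry we may assume that `e = e₁`"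
[Richthammer2007, §5.1, p. 10]. This file proves that symmetry for the Euclidean hard disc:
the coordinate swap `s(x₁, x₂) = (x₂, x₁)` is a linear isometry of `ℝ²` preserving Lebesgue
measure, the boxes `Λ_r` and the hard core; it acts on configurations (`PointConfig.mapHomeomorph`,
a new generic operation: image of a locally finite configuration under a homeomorphism), and

* `weight_mapSwap`, `gibbsKernel_mapSwap` — the finite-volume weights are swap-covariant,
  `W_Λ(A | sX̄) = W_{s⁻¹Λ}(s⁻¹A | X̄)`;
* `IsGibbs.map_swap` — the image of a Gibbs measure is a Gibbs measure;
* `IsCylinderEvent.preimage_mapSwap` — `s⁻¹𝓕_{𝒳,Λ_m} ⊆ 𝓕_{𝒳,Λ_m}`;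
* `Richthammer2007_ineq58_of_dir0` — **the named fact `Richthammer2007_ineq58` follows from
  its restriction to the direction `e₁ = EuclideanSpace.single 0 1`**.

## References

* [Richthammer2007] T. Richthammer, *Translation-invariance of two-dimensional Gibbsian point
  processes*, Comm. Math. Phys. 274 (2007) 81–122, arXiv:0706.3637: §3.5 (p. 8), §5.1 (p. 10).
-/

noncomputable section

open MeasureTheory Set Function
open scoped ENNReal

/-! ### Images of configurations under homeomorphisms -/

namespace Literature.Analysis.FunctionSpaces.PointConfig

variable {E F : Type*} [TopologicalSpace E] [TopologicalSpace F]

/-- The image of a locally finite configuration under a homeomorphism (generalises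
`PointConfig.translate`; local finiteness is preserved because preimages of compact sets are
compact). A generic dot-notation extension of the tree's `PointConfig`, declared from
`Literature/Barriers`. [folklore] -/
protected def mapHomeomorph (φ : E ≃ₜ F) (c : PointConfig E) : PointConfig F where
  carrier := φ '' c.carrier
  finite_inter_isCompact K hK := by
    rw [← Set.image_inter_preimage]
    exact (c.finite_inter_isCompact _ (φ.isCompact_preimage.2 hK)).image _

/-- Carrier of the image configuration. [folklore] -/
@[simp] theorem carrier_mapHomeomorph (φ : E ≃ₜ F) (c : PointConfig E) :
    (c.mapHomeomorph φ).carrier = φ '' c.carrier := rfl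

/-- Membership in the image configuration. [folklore] -/
theorem mem_mapHomeomorph_iff (φ : E ≃ₜ F) (c : PointConfig E) (y : F) :
    y ∈ c.mapHomeomorph φ ↔ φ.symm y ∈ c := by
  change y ∈ φ '' c.carrier ↔ _
  rw [Homeomorph.image_eq_preimage_symm]
  rfl

/-- `φ x ∈ φ(c) ↔ x ∈ c`. [folklore] -/
theorem apply_mem_mapHomeomorph_iff (φ : E ≃ₜ F) (c : PointConfig E) (x : E) :
    φ x ∈ c.mapHomeomorph φ ↔ x ∈ c := by
  rw [mem_mapHomeomorph_iff, Homeomorph.symm_apply_apply]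

/-- `φ⁻¹(φ(c)) = c`. [folklore] -/
theorem mapHomeomorph_mapHomeomorph_symm (φ : E ≃ₜ F) (c : PointConfig E) :
    (c.mapHomeomorph φ).mapHomeomorph φ.symm = c := by
  ext x
  rw [mem_mapHomeomorph_iff, Homeomorph.symm_symm, apply_mem_mapHomeomorph_iff]

/-- `φ(φ⁻¹(c)) = c`. [folklore] -/
theorem mapHomeomorph_symm_mapHomeomorph (φ : E ≃ₜ F) (c : PointConfig F) :
    (c.mapHomeomorph φ.symm).mapHomeomorph φ = c := by
  have h := mapHomeomorph_mapHomeomorph_symm φ.symm c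
  rwa [Homeomorph.symm_symm] at h

/-- Counting after mapping: `N_{φ(c)}(s) = N_c(φ⁻¹ s)`. [folklore] -/
theorem count_mapHomeomorph (φ : E ≃ₜ F) (c : PointConfig E) (s : Set F) :
    (c.mapHomeomorph φ).count s = c.count (φ ⁻¹' s) := by
  simp only [count, carrier_mapHomeomorph, ← Set.image_inter_preimage]
  exact φ.injective.encard_image _

/-- Restriction after mapping: `φ(c)_s = φ(c_{φ⁻¹ s})`. [folklore] -/
theorem restrict_mapHomeomorph (φ : E ≃ₜ F) (c : PointConfig E) (s : Set F) :
    (c.mapHomeomorph φ).restrict s = (c.restrict (φ ⁻¹' s)).mapHomeomorph φ := by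
  ext y
  change y ∈ φ '' c.carrier ∩ s ↔ y ∈ φ '' (c.carrier ∩ φ ⁻¹' s)
  rw [Set.image_inter_preimage]

/-- Mapping is measurable (its counting maps are counting maps of preimages). [folklore] -/
theorem measurable_mapHomeomorph [MeasurableSpace E] [MeasurableSpace F] [BorelSpace E]
    [BorelSpace F] (φ : E ≃ₜ F) :
    Measurable (PointConfig.mapHomeomorph φ : PointConfig E → PointConfig F) :=
  measurable_of_count fun s hs => by
    simp only [count_mapHomeomorph]
    exact measurable_count (φ.measurable hs)

/-- Translation then mapping by an additive homeomorphism: `φ(c + v) = φ(c) + φ(v)`. [folklore] -/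
theorem mapHomeomorph_translate [AddGroup E] [ContinuousAdd E] [AddGroup F] [ContinuousAdd F]
    (φ : E ≃ₜ F) (hφ : ∀ x y, φ (x + y) = φ x + φ y) (v : E) (c : PointConfig E) :
    (c.translate v).mapHomeomorph φ = (c.mapHomeomorph φ).translate (φ v) := by
  ext y
  rw [mem_mapHomeomorph_iff, mem_translate_iff, mem_translate_iff, mem_mapHomeomorph_iff]
  have : φ.symm y - v = φ.symm (y - φ v) := by
    apply φ.injective
    rw [Homeomorph.apply_symm_apply, eq_sub_iff_add_eq, ← hφ, sub_add_cancel,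
      Homeomorph.apply_symm_apply]
  rw [this]

end Literature.Analysis.FunctionSpaces.PointConfig

namespace Literature.Barriers.AtomisticToContinuum.HardDisk

open Literature.Analysis.FunctionSpaces

/-! ### The coordinate swap of the plane -/

/-- The coordinate swap `s(x₁, x₂) = (x₂, x₁)` as a linear isometry of `ℝ²`. [folklore] -/
def planeSwap : EuclideanSpace ℝ (Fin 2) ≃ₗᵢ[ℝ] EuclideanSpace ℝ (Fin 2) :=
  LinearIsometryEquiv.piLpCongrLeft 2 ℝ ℝ (Equiv.swap (0 : Fin 2) 1)

/-- Coordinates of the swap. [folklore] -/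
theorem planeSwap_apply (x : EuclideanSpace ℝ (Fin 2)) (k : Fin 2) :
    planeSwap x k = x (Equiv.swap (0 : Fin 2) 1 k) := by
  have h := LinearIsometryEquiv.piLpCongrLeft_apply (p := 2) (𝕜 := ℝ) (E := ℝ)
    (Equiv.swap (0 : Fin 2) 1) x
  have : (planeSwap x) k = ((LinearIsometryEquiv.piLpCongrLeft 2 ℝ ℝ
    (Equiv.swap (0 : Fin 2) 1)) x).ofLp k := rfl
  rw [this, h, Equiv.piCongrLeft'_apply, Equiv.symm_swap]

/-- The swap is an involution. [folklore] -/
theorem planeSwap_planeSwap (x : EuclideanSpace ℝ (Fin 2)) : planeSwap (planeSwap x) = x := by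
  ext k
  rw [planeSwap_apply, planeSwap_apply, Equiv.swap_apply_self]

/-- The swap as a homeomorphism of the plane. [folklore] -/
abbrev planeSwapH : EuclideanSpace ℝ (Fin 2) ≃ₜ EuclideanSpace ℝ (Fin 2) := planeSwap.toHomeomorph

/-- `s⁻¹ = s` (for the homeomorphism). [folklore] -/
theorem planeSwapH_symm_apply (x : EuclideanSpace ℝ (Fin 2)) : planeSwapH.symm x = planeSwap x := by
  apply planeSwapH.injective
  rw [Homeomorph.apply_symm_apply]
  exact (planeSwap_planeSwap x).symm

/-- Membership in a swapped configuration. [folklore] -/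
theorem mem_mapSwap_iff (X : PointConfig (EuclideanSpace ℝ (Fin 2))) (y : EuclideanSpace ℝ (Fin 2)) :
    y ∈ X.mapHomeomorph planeSwapH ↔ planeSwap y ∈ X := by
  rw [PointConfig.mem_mapHomeomorph_iff, planeSwapH_symm_apply]

/-- Swapping twice is the identity on configurations. [folklore] -/
theorem mapSwap_mapSwap (X : PointConfig (EuclideanSpace ℝ (Fin 2))) :
    (X.mapHomeomorph planeSwapH).mapHomeomorph planeSwapH = X := by
  ext y
  rw [mem_mapSwap_iff, mem_mapSwap_iff, planeSwap_planeSwap]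

/-- The preimage of an event under the swap, twice. [folklore] -/
theorem preimage_mapSwap_preimage_mapSwap (A : Set (PointConfig (EuclideanSpace ℝ (Fin 2)))) :
    PointConfig.mapHomeomorph planeSwapH ⁻¹' (PointConfig.mapHomeomorph planeSwapH ⁻¹' A) = A := by
  ext X
  simp only [mem_preimage, mapSwap_mapSwap]

/-- The swap exchanges the coordinate directions: `s(a e_i) = a e_{swap i}`. [folklore] -/
theorem planeSwap_smul_single (a : ℝ) (i : Fin 2) :
    planeSwap (a • EuclideanSpace.single i (1 : ℝ)) =
      a • EuclideanSpace.single (Equiv.swap (0 : Fin 2) 1 i) (1 : ℝ) := by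
  ext k
  rw [planeSwap_apply]
  fin_cases i <;> fin_cases k <;> simp [Equiv.swap_apply_left, Equiv.swap_apply_right]

/-- The boxes `Λ_r` are swap invariant. [folklore] -/
theorem preimage_planeSwap_box (r : ℝ) : planeSwap ⁻¹' box r = box r := by
  ext x
  simp only [mem_preimage, mem_box, planeSwap_apply]
  constructor
  · intro h i
    have := h (Equiv.swap (0 : Fin 2) 1 i)
    rwa [Equiv.swap_apply_self] at this
  · intro h i
    exact h _

/-- The swap preserves Lebesgue measure. [folklore] -/
theorem measurePreserving_planeSwap :
    MeasurePreserving planeSwap (volume : Measure (EuclideanSpace ℝ (Fin 2))) volume :=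
  planeSwap.measurePreserving

/-! ### Swap covariance of the hard-disc specification -/

/-- **The hard core is swap invariant** (the swap is an isometry). [folklore] -/
theorem hardCoreIn_mapSwap_iff (Λ : Set (EuclideanSpace ℝ (Fin 2)))
    (X : PointConfig (EuclideanSpace ℝ (Fin 2))) :
    HardCoreIn Λ (X.mapHomeomorph planeSwapH) ↔ HardCoreIn (planeSwap ⁻¹' Λ) X := by
  constructor
  · intro h p hp q hq hpq hΛ
    have hp' : planeSwap p ∈ X.mapHomeomorph planeSwapH := by
      rw [mem_mapSwap_iff, planeSwap_planeSwap]; exact hp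
    have hq' : planeSwap q ∈ X.mapHomeomorph planeSwapH := by
      rw [mem_mapSwap_iff, planeSwap_planeSwap]; exact hq
    have key := h _ hp' _ hq' (fun e => hpq (planeSwap.injective e)) hΛ
    rwa [planeSwap.dist_map] at key
  · intro h p hp q hq hpq hΛ
    rw [mem_mapSwap_iff] at hp hq
    have hΛ' : planeSwap p ∈ planeSwap ⁻¹' Λ ∨ planeSwap q ∈ planeSwap ⁻¹' Λ := by
      simpa only [mem_preimage, planeSwap_planeSwap] using hΛ
    have key := h _ hp _ hq (fun e => hpq (planeSwap.injective e)) hΛ'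
    rwa [planeSwap.dist_map] at key

/-- **Superposition is swap covariant**:
`(s x)_Λ (sX̄)_{Λᶜ} = s (x_{s⁻¹Λ} X̄_{(s⁻¹Λ)ᶜ})`. [folklore] -/
theorem superpose_mapSwap (Λ : Set (EuclideanSpace ℝ (Fin 2))) {k : ℕ}
    (x : Fin k → EuclideanSpace ℝ (Fin 2)) (Y : PointConfig (EuclideanSpace ℝ (Fin 2))) :
    superpose Λ (fun i => planeSwap (x i)) (Y.mapHomeomorph planeSwapH) =
      (superpose (planeSwap ⁻¹' Λ) x Y).mapHomeomorph planeSwapH := by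
  ext p
  rw [mem_mapSwap_iff, mem_superpose, mem_superpose, mem_mapSwap_iff]
  simp only [mem_range, mem_preimage, planeSwap_planeSwap]
  constructor
  · rintro (⟨⟨i, hi⟩, hΛ⟩ | ⟨hy, hΛ⟩)
    · exact Or.inl ⟨⟨i, by rw [← hi, planeSwap_planeSwap]⟩, hΛ⟩
    · exact Or.inr ⟨hy, hΛ⟩
  · rintro (⟨⟨i, hi⟩, hΛ⟩ | ⟨hy, hΛ⟩)
    · exact Or.inl ⟨⟨i, by rw [hi, planeSwap_planeSwap]⟩, hΛ⟩
    · exact Or.inr ⟨hy, hΛ⟩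

/-- The coordinate-wise swap of `(ℝ²)^k` as a measurable automorphism. [folklore] -/
abbrev piSwap (k : ℕ) : (Fin k → EuclideanSpace ℝ (Fin 2)) ≃ᵐ (Fin k → EuclideanSpace ℝ (Fin 2)) :=
  MeasurableEquiv.piCongrRight fun _ : Fin k => planeSwapH.toMeasurableEquiv

/-- `piSwap` acts coordinate-wise. [folklore] -/
theorem piSwap_apply (k : ℕ) (x : Fin k → EuclideanSpace ℝ (Fin 2)) :
    piSwap k x = fun i => planeSwap (x i) := rfl

/-- Lebesgue measure on `Λ^k` is the image of Lebesgue measure on `(s⁻¹Λ)^k` under the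
coordinate-wise swap. [folklore] -/
theorem pi_restrict_eq_map_swap (k : ℕ) (Λ : Set (EuclideanSpace ℝ (Fin 2))) :
    (Measure.pi fun _ : Fin k => (volume : Measure (EuclideanSpace ℝ (Fin 2))).restrict Λ) =
      (Measure.pi fun _ : Fin k =>
        (volume : Measure (EuclideanSpace ℝ (Fin 2))).restrict (planeSwap ⁻¹' Λ)).map (piSwap k) := by
  have h1 : MeasurePreserving planeSwap ((volume : Measure (EuclideanSpace ℝ (Fin 2))).restrict
      (planeSwap ⁻¹' Λ)) (volume.restrict Λ) :=
    measurePreserving_planeSwap.restrict_preimage_emb planeSwapH.measurableEmbedding Λ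
  exact ((measurePreserving_pi _ _ fun _ : Fin k => h1).map_eq).symm

/-- **The finite-volume weights are swap covariant**:
`weight z Λ (sX̄) A = weight z (s⁻¹Λ) X̄ (s⁻¹A)`. [cite: Richthammer2007, §5.1 (p. 10, "by symmetry")] -/
theorem weight_mapSwap (z : ℝ) (Λ : Set (EuclideanSpace ℝ (Fin 2)))
    (Y : PointConfig (EuclideanSpace ℝ (Fin 2))) (A : Set (PointConfig (EuclideanSpace ℝ (Fin 2)))) :
    weight z Λ (Y.mapHomeomorph planeSwapH) A =
      weight z (planeSwap ⁻¹' Λ) Y (PointConfig.mapHomeomorph planeSwapH ⁻¹' A) := by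
  unfold weight
  refine tsum_congr fun k => ?_
  congr 1
  rw [pi_restrict_eq_map_swap k Λ, lintegral_map_equiv]
  refine lintegral_congr fun x => ?_
  rw [piSwap_apply, superpose_mapSwap]
  by_cases hmem : (superpose (planeSwap ⁻¹' Λ) x Y).mapHomeomorph planeSwapH ∈
      A ∩ {X | HardCoreIn Λ X}
  · have hmem' : superpose (planeSwap ⁻¹' Λ) x Y ∈
        PointConfig.mapHomeomorph planeSwapH ⁻¹' A ∩ {X | HardCoreIn (planeSwap ⁻¹' Λ) X} :=
      ⟨hmem.1, (hardCoreIn_mapSwap_iff Λ _).1 hmem.2⟩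
    rw [indicator_of_mem hmem, indicator_of_mem hmem']
    rfl
  · have hmem' : superpose (planeSwap ⁻¹' Λ) x Y ∉
        PointConfig.mapHomeomorph planeSwapH ⁻¹' A ∩ {X | HardCoreIn (planeSwap ⁻¹' Λ) X} :=
      fun h' => hmem ⟨h'.1, (hardCoreIn_mapSwap_iff Λ _).2 h'.2⟩
    rw [indicator_of_notMem hmem, indicator_of_notMem hmem']

/-- **The specification is swap covariant**: `γ_Λ(A | sX̄) = γ_{s⁻¹Λ}(s⁻¹A | X̄)`.
[cite: Richthammer2007, §5.1 (p. 10)] -/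
theorem gibbsKernel_mapSwap (z : ℝ) (Λ : Set (EuclideanSpace ℝ (Fin 2)))
    (Y : PointConfig (EuclideanSpace ℝ (Fin 2))) (A : Set (PointConfig (EuclideanSpace ℝ (Fin 2)))) :
    gibbsKernel z Λ (Y.mapHomeomorph planeSwapH) A =
      gibbsKernel z (planeSwap ⁻¹' Λ) Y (PointConfig.mapHomeomorph planeSwapH ⁻¹' A) := by
  rw [gibbsKernel, gibbsKernel, weight_mapSwap, weight_mapSwap, Set.preimage_univ]

/-- Swapped windows of bounded windows are bounded. [folklore] -/
theorem isBounded_preimage_planeSwap {Λ : Set (EuclideanSpace ℝ (Fin 2))}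
    (hb : Bornology.IsBounded Λ) : Bornology.IsBounded (planeSwap ⁻¹' Λ) := by
  obtain ⟨R, hR⟩ := (Metric.isBounded_iff_subset_closedBall (0 : EuclideanSpace ℝ (Fin 2))).1 hb
  refine (Metric.isBounded_iff_subset_closedBall (0 : EuclideanSpace ℝ (Fin 2))).2
    ⟨R, fun x hx => ?_⟩
  have h := hR hx
  rw [Metric.mem_closedBall, dist_zero_right] at h ⊢
  rwa [planeSwap.norm_map] at h

/-- **The swap maps Gibbs measures to Gibbs measures**: the DLR equation in `Λ` for the image
measure is the DLR equation in `s⁻¹Λ` for `μ` (`gibbsKernel_mapSwap`).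
[cite: Richthammer2007, §5.1 (p. 10, "by symmetry we may assume that `e = e₁`")] -/
theorem IsGibbs.map_swap {z : ℝ} {μ : Measure (PointConfig (EuclideanSpace ℝ (Fin 2)))}
    (hμ : IsGibbs z μ) : IsGibbs z (μ.map (PointConfig.mapHomeomorph planeSwapH)) := by
  haveI := hμ.1
  have hmeas : Measurable (PointConfig.mapHomeomorph planeSwapH :
      PointConfig (EuclideanSpace ℝ (Fin 2)) → PointConfig (EuclideanSpace ℝ (Fin 2))) :=
    PointConfig.measurable_mapHomeomorph planeSwapH
  refine ⟨Measure.isProbabilityMeasure_map hmeas.aemeasurable, fun Λ hΛ hb A hA => ?_⟩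
  let e : PointConfig (EuclideanSpace ℝ (Fin 2)) ≃ᵐ PointConfig (EuclideanSpace ℝ (Fin 2)) :=
    { toFun := PointConfig.mapHomeomorph planeSwapH
      invFun := PointConfig.mapHomeomorph planeSwapH
      left_inv := mapSwap_mapSwap
      right_inv := mapSwap_mapSwap
      measurable_toFun := hmeas
      measurable_invFun := hmeas }
  rw [Measure.map_apply hmeas hA,
    hμ.2 _ (planeSwap.continuous.measurable hΛ) (isBounded_preimage_planeSwap hb) _
      (hA.preimage hmeas),
    show (PointConfig.mapHomeomorph planeSwapH :
      PointConfig (EuclideanSpace ℝ (Fin 2)) → PointConfig (EuclideanSpace ℝ (Fin 2))) = ⇑e from rfl,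
    lintegral_map_equiv]
  refine lintegral_congr fun Y => ?_
  exact (gibbsKernel_mapSwap z Λ Y A).symm

/-! ### Cylinder events and translates under the swap -/

/-- `s⁻¹ 𝓕_{𝒳,Λ} ⊆ 𝓕_{𝒳,s⁻¹Λ}`. [folklore] -/
theorem IsCylinderEvent.preimage_mapSwap {Λ : Set (EuclideanSpace ℝ (Fin 2))}
    {D : Set (PointConfig (EuclideanSpace ℝ (Fin 2)))} (hD : IsCylinderEvent Λ D) :
    IsCylinderEvent (planeSwap ⁻¹' Λ) (PointConfig.mapHomeomorph planeSwapH ⁻¹' D) := by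
  obtain ⟨B, hB, rfl⟩ := isCylinderEvent_iff.1 hD
  refine isCylinderEvent_iff.2 ⟨PointConfig.mapHomeomorph planeSwapH ⁻¹' B,
    hB.preimage (PointConfig.measurable_mapHomeomorph _), ?_⟩
  ext X
  simp only [mem_preimage]
  rw [PointConfig.restrict_mapHomeomorph]
  rfl

/-- Cylinder events of a box are swap stable: `s⁻¹ 𝓕_{𝒳,Λ_m} ⊆ 𝓕_{𝒳,Λ_m}`. [folklore] -/
theorem IsCylinderEvent.preimage_mapSwap_box {r : ℝ}
    {D : Set (PointConfig (EuclideanSpace ℝ (Fin 2)))} (hD : IsCylinderEvent (box r) D) :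
    IsCylinderEvent (box r) (PointConfig.mapHomeomorph planeSwapH ⁻¹' D) := by
  have h := hD.preimage_mapSwap
  rwa [preimage_planeSwap_box] at h

/-- Translates of swapped events: `g_u⁻¹(s⁻¹D) = s⁻¹(g_{su}⁻¹ D)`. [folklore] -/
theorem preimage_translate_preimage_mapSwap (u : EuclideanSpace ℝ (Fin 2))
    (D : Set (PointConfig (EuclideanSpace ℝ (Fin 2)))) :
    PointConfig.translate u ⁻¹' (PointConfig.mapHomeomorph planeSwapH ⁻¹' D) =
      PointConfig.mapHomeomorph planeSwapH ⁻¹' (PointConfig.translate (planeSwap u) ⁻¹' D) := by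
  ext X
  simp only [mem_preimage]
  rw [PointConfig.mapHomeomorph_translate planeSwapH (fun x y => planeSwap.map_add x y) u X]
  rfl

/-! ### The reduction to the direction `e₁` -/

/-- **"By symmetry we may assume `e = e₁`"** (Richthammer 2007, §5.1): the named fact
`Richthammer2007_ineq58` follows from its restriction to the direction
`e₁ = EuclideanSpace.single 0 1`. For `e₂`, apply the `e₁`-statement to the swapped Gibbs
measure `μ ∘ s⁻¹` (`IsGibbs.map_swap`) and the swapped cylinder event `s⁻¹D`
(`IsCylinderEvent.preimage_mapSwap_box`), take `G := s⁻¹G'`, and transport the weight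
inequality back boundary condition by boundary condition (`weight_mapSwap`,
`preimage_translate_preimage_mapSwap`, `s(te₁) = te₂`). [cite: Richthammer2007, §5.1 (p. 10)] -/
theorem Richthammer2007_ineq58_of_dir0
    (h : ∀ z : ℝ, 0 < z → ∀ μ : Measure (PointConfig (EuclideanSpace ℝ (Fin 2))), IsGibbs z μ →
      ∀ t : ℝ, 0 ≤ t → t ≤ 1 / 2 → ∀ m : ℕ, ∀ D : Set (PointConfig (EuclideanSpace ℝ (Fin 2))),
        IsCylinderEvent (box m) D → ∀ δ : ℝ, 0 < δ →
          ∃ n : ℕ, m < n ∧ ∃ G : Set (PointConfig (EuclideanSpace ℝ (Fin 2))), MeasurableSet G ∧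
            μ Gᶜ ≤ ENNReal.ofReal δ ∧
              ∀ Y : PointConfig (EuclideanSpace ℝ (Fin 2)),
                weight z (box n) Y (D ∩ G) ≤
                  weight z (box n) Y
                      (PointConfig.translate ((t : ℝ) • EuclideanSpace.single (0 : Fin 2) (1 : ℝ)) ⁻¹' D) +
                    weight z (box n) Y
                      (PointConfig.translate (-((t : ℝ) • EuclideanSpace.single (0 : Fin 2) (1 : ℝ))) ⁻¹' D)) :
    Richthammer2007_ineq58 := by
  intro z hz μ hμ i t ht0 ht1 m D hD δ hδ
  by_cases hi : i = 0
  · subst hi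
    exact h z hz μ hμ t ht0 ht1 m D hD δ hδ
  · have hi1 : i = 1 := by
      fin_cases i
      · exact absurd rfl hi
      · rfl
    subst hi1
    -- direction `e₂`: transport by the swap
    have hΦm : Measurable (PointConfig.mapHomeomorph planeSwapH :
        PointConfig (EuclideanSpace ℝ (Fin 2)) → PointConfig (EuclideanSpace ℝ (Fin 2))) :=
      PointConfig.measurable_mapHomeomorph _
    obtain ⟨n, hn, G', hG', hμG', hW⟩ :=
      h z hz _ hμ.map_swap t ht0 ht1 m _ hD.preimage_mapSwap_box δ hδ
    refine ⟨n, hn, PointConfig.mapHomeomorph planeSwapH ⁻¹' G', hG'.preimage hΦm, ?_, fun Y => ?_⟩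
    · rw [← Set.preimage_compl, ← Measure.map_apply hΦm hG'.compl]
      exact hμG'
    · have key := hW (Y.mapHomeomorph planeSwapH)
      rw [preimage_translate_preimage_mapSwap, preimage_translate_preimage_mapSwap,
        weight_mapSwap, weight_mapSwap, weight_mapSwap, preimage_planeSwap_box, Set.preimage_inter,
        preimage_mapSwap_preimage_mapSwap, preimage_mapSwap_preimage_mapSwap,
        preimage_mapSwap_preimage_mapSwap, map_neg, planeSwap_smul_single] at key
      simpa [Equiv.swap_apply_left] using key

end Literature.Barriers.AtomisticToContinuum.HardDisk

end
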